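/-
Origin: expansion seat `planner-pub-hodgecm-pv13-0`, handover 2026-08-18 (`HOME/pub-hodgecm-pv13/lean/Pv13/ConstituentCore.lean`, md5 07028511, 137 lines);
landed by the gen-6 packager in gate run 22 as `HodgeCM/PerL34/ConstituentCore.lean` (import ^import Pv[0-9]+\.→import HodgeCM.PerL34. ×1).
-/
/-
Origin: pub-hodgecm-pv13 (DAG-NODE PROVER #13) — clause (β) of Def 3.2 / L4.2(b) second half (tex ll. 632–635)
"for EVERY type-w character" (LEMMAS v5 §10, carverg2-X2 caveat (β) = pv13 (u2)): the per-character KERNEL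
statement `ConstituentDictionary.archType_matches` of `ConstituentSplit` RESTATED over the bare set of theta
lifts `Θ ⊆ L²([G_U])`, with NO `LocalFactorDatum` (no Euler product / Rallis / local factors) in its parameters —
the shape the S^all path consumes (it survives `allowed := fun _ => True`).  Imports `Pv13.ConstituentSplit`
(→ `HodgeCM.PerL34.ConstituentSplit`).  Proposed place: `HodgeCM/PerL34/ConstituentCore.lean`, namespace
`HodgeCM.PerL34.EulerProduct`.  Nothing cited, nothing asserted.
-/
import Summits.HodgeConjecture.HodgeCM.PerL34.ConstituentSplit

set_option autoImplicit false

/-!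
# Clause (β) per character, free of the analytic datum

* `ConstituentCore Gi HG Θ` — the dictionary of `ConstituentSplit.ConstituentDictionary` with the family of
  local-factor data `L : D.X → LocalFactorDatum Pl HG` replaced by the bare set `Θ : Set HG` of lifts
  `θ(φ', χ')` of ONE character (fields and print labels identical: (r1) `arch`, (r2) `archType/gen/…`,
  (r2′) `dl` = densely-defined equivariant lifts, (D5) `Constituent`).
* `ConstituentCore.archType_matches` — KERNEL: every irreducible constituent of the closure of `span Θ` has
  archimedean component `≅ arch` (`Schur.local_component_of_constituent`).
* `ConstituentDictionary.core` — the analytic-path dictionary restricts to a core with `Θ = (L χ).Theta`, and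
  `archType_matches` of the former is literally that of the latter (`archType_matches_eq_core`).
So on the §10 path (S₁₂^all) clause (β) for a type-w character `χ = χ'₁ ⊠ χ'₂` is: two `ConstituentCore`s (one
per line), no N31 analytic input; on the PerL-v5-as-written path it is the same statement inside `AllowedBridge`.
-/

noncomputable section

open scoped InnerProductSpace
open ContinuousLinearMap

namespace HodgeCM
namespace PerL34
namespace EulerProduct

open HodgeCM.PerL34.Schur

variable {HG : Type*} [NormedAddCommGroup HG] [InnerProductSpace ℂ HG] [CompleteSpace HG]

/-- **Clause (β) dictionary for ONE character and ONE line, over the bare set of lifts `Θ`.** -/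
structure ConstituentCore (Gi : Type) [Group Gi] (HG : Type*) [NormedAddCommGroup HG] [InnerProductSpace ℂ HG]
    [CompleteSpace HG] (Θ : Set HG) where
  /-- (r4 / D2) the unitary action of `G∞` on `L²([G_U])` -/
  τ : Gi →* unitary (HG →L[ℂ] HG)
  /-- (r1) PRINT: the irreducible unitary `V_{χ̄'}` of `G∞` (BW VIII 2.10, 2.14; N28) -/
  arch : IrrepPkg Gi
  /-- (r2′ / D2) finite test vectors -/
  LiftIdx : Type
  /-- (r2′) densely-defined equivariant lifts `v ↦ θ(v ⊗ φ_f, χ')` (norm bound DERIVED from N31e + N31f) -/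
  dl : LiftIdx → Schur.DenseLift arch.σ τ
  /-- l. 633 first clause: `π = span Θ` lies in the closed span of the lifts from `V_{χ̄'}` -/
  span_le : Submodule.span ℂ Θ ≤ (⨆ j, LinearMap.range (dl j).lift.toLinearMap).topologicalClosure
  /-- (D5) irreducible constituents of the closure of `π` -/
  Constituent : Submodule ℂ HG → Prop
  constituent_closed : ∀ K, Constituent K → IsClosed (K : Set HG)
  constituent_inv : ∀ K, Constituent K → Schur.Invariant (Schur.ops τ) K
  constituent_ne_bot : ∀ K, Constituent K → K ≠ ⊥
  constituent_le : ∀ K, Constituent K → K ≤ (Submodule.span ℂ Θ).topologicalClosure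
  /-- (r2) PRINT: archimedean component of a constituent and its generating intertwiners -/
  archType : ∀ K, Constituent K → IrrepPkg Gi
  GenIdx : Type
  gen : ∀ K (h : Constituent K), GenIdx → ((archType K h).W →L[ℂ] HG)
  gen_intertwines : ∀ K (h : Constituent K) (i : GenIdx), Schur.Intertwines (archType K h).σ τ (gen K h i)
  gen_dense : ∀ K (h : Constituent K), K ≤ (⨆ i, LinearMap.range (gen K h i).toLinearMap).topologicalClosure

namespace ConstituentCore

variable {Gi : Type} [Group Gi] {Θ : Set HG}

/-- the bounded lifts (KERNEL extension by density) -/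
def lift (δ : ConstituentCore Gi HG Θ) (j : δ.LiftIdx) : δ.arch.W →L[ℂ] HG := (δ.dl j).lift

/-- (Ported verbatim from the HodgeCMPerL package; no docstring in the source.) -/
theorem lift_intertwines (δ : ConstituentCore Gi HG Θ) (j : δ.LiftIdx) :
    Schur.Intertwines δ.arch.σ δ.τ (δ.lift j) :=
  (δ.dl j).lift_intertwines

/-- "every irreducible constituent of the closure of `π` has archimedean component `≅ V_{χ̄'}`" -/
def ArchTypeMatches (δ : ConstituentCore Gi HG Θ) : Prop :=
  ∀ K (h : δ.Constituent K), ∃ U : δ.arch.W ≃ₗᵢ[ℂ] (δ.archType K h).W,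
    ∀ (g : Gi) (x : δ.arch.W), U ((δ.arch.σ g : δ.arch.W →L[ℂ] δ.arch.W) x) =
      ((δ.archType K h).σ g : (δ.archType K h).W →L[ℂ] (δ.archType K h).W) (U x)

/-- **KERNEL (clause (β) per character, no analytic input).** -/
theorem archType_matches (δ : ConstituentCore Gi HG Θ) : δ.ArchTypeMatches := by
  intro K hK
  have hKle : K ≤ (⨆ j, LinearMap.range (δ.lift j).toLinearMap).topologicalClosure :=
    (δ.constituent_le K hK).trans
      (Submodule.topologicalClosure_minimal _ δ.span_le (Submodule.isClosed_topologicalClosure _))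
  exact Schur.local_component_of_constituent δ.arch.irred (δ.archType K hK).irred δ.lift δ.lift_intertwines K
    (δ.constituent_closed K hK) (δ.constituent_inv K hK) (δ.constituent_ne_bot K hK) hKle (δ.gen K hK)
    (δ.gen_intertwines K hK) (δ.gen_dense K hK)

end ConstituentCore

section Restrict

open HodgeCM.Prior.Perl34File

variable {H CG G SK SigIdx SigIdxG : Type*}
variable [NormedAddCommGroup H] [InnerProductSpace ℂ H] [CompleteSpace H]
variable [NormedAddCommGroup CG] [NormedSpace ℂ CG]
variable [Group G] [TopologicalSpace G] [TopologicalSpace SK]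
variable {C : Perl34.IsolationCore H HG CG G SK SigIdx SigIdxG}
variable {Pl : Type} {D : Perl34.TorusData C} {L : D.X → LocalFactorDatum Pl HG} {χ : D.X}

/-- The analytic-path dictionary restricts to the core over `Θ = (L χ).Theta`. -/
def ConstituentDictionary.core (δ : ConstituentDictionary D L χ) : ConstituentCore δ.Gi HG (L χ).Theta where
  τ := δ.τ
  arch := δ.arch
  LiftIdx := δ.LiftIdx
  dl := δ.dl
  span_le := δ.span_le
  Constituent := δ.Constituent
  constituent_closed := δ.constituent_closed
  constituent_inv := δ.constituent_inv
  constituent_ne_bot := δ.constituent_ne_bot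
  constituent_le := δ.constituent_le
  archType := δ.archType
  GenIdx := δ.GenIdx
  gen := δ.gen
  gen_intertwines := δ.gen_intertwines
  gen_dense := δ.gen_dense

/-- … and its constituent clause IS the core's. -/
theorem ConstituentDictionary.archTypeMatches_iff_core (δ : ConstituentDictionary D L χ) :
    δ.ArchTypeMatches ↔ δ.core.ArchTypeMatches :=
  Iff.rfl

end Restrict

end EulerProduct
end PerL34
end HodgeCM

end
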